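import Summits.MatrixMultiplication.MatrixMultiplication.Theorems.SoloBlindAllPresent

/-!
# Presence induction: one-sided absence reduces the corank

Sub-programme (K₃) / Conjecture E (K3.31, Q-K78).  `S = B ∪ X` with `B`, `X` disjoint, `x ∈ X`, `X' = X \ {x}`.  The
one-step deletion `K(τ; B ∪ X) = K(τ; B ∪ X') + ½ K(τ - h x; B ∪ X')` shows that if the representations are
ONE-SIDED in `x` — no shifted target `τ - h x - ∑_C h` (`C ⊆ X'`) is representable in `B`, or no target
`τ - ∑_C h` (`C ⊆ X'`) is — then (K₃), resp. Conjecture E, at corank `|X|` follows from (K₃) (resp. (K₃) and E) at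
corank `|X| - 1`.  Together with the all-present theorem (`soloBlind_kraft_allPresent`, `soloBlind_conjE_allPresent`)
this localises the corank-`m` content of (K₃) / E in the presence families `𝓕 ⊊ 2^X` that hit both sides of every
coordinate of `2^X` (at corank two: the kills `Q1, Q2, K-a, K-b, K-c`).

* `soloBlind_union_erase_eq` — `(B ∪ X) \ {x} = B ∪ X'` for `x ∉ B`.
* `soloBlind_mass_union_step` — the one-step deletion over `B ∪ X`.
* `soloBlind_mass_union_eq_zero_of_absent` — no target `τ - ∑_C h` (`C ⊆ X`) representable ⟹ `K(τ; B ∪ X) = 0`.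
* `soloBlind_kraft_presence_step`, `soloBlind_conjE_presence_step` — the one-sided reductions.
-/

namespace Summit.MatrixMultiplication.MatrixMultiplication.Theorems

open Finset

universe u

variable {ι : Type*} [DecidableEq ι]
variable {G : Type u} [AddCommGroup G] [DecidableEq G]

omit [DecidableEq G] in
/-- `(B ∪ X).erase x = B ∪ X.erase x` when `x ∉ B`. -/
theorem soloBlind_union_erase_eq {B X : Finset ι} {x : ι} (hxB : x ∉ B) :
    (B ∪ X).erase x = B ∪ X.erase x := by
  ext i
  simp only [Finset.mem_erase, Finset.mem_union]
  constructor
  · rintro ⟨hix, hi | hi⟩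
    · exact Or.inl hi
    · exact Or.inr ⟨hix, hi⟩
  · rintro (hi | ⟨hix, hi⟩)
    · exact ⟨fun e => hxB (e ▸ hi), Or.inl hi⟩
    · exact ⟨hix, Or.inr hi⟩

/-- One-step deletion over `B ∪ X` at an outside index `x ∈ X`. -/
theorem soloBlind_mass_union_step (h : ι → G) {B X : Finset ι} (hd : Disjoint B X) {x : ι} (hx : x ∈ X)
    (τ : G) :
    soloBlindMass h (B ∪ X) τ =
      soloBlindMass h (B ∪ X.erase x) τ + 1 / 2 * soloBlindMass h (B ∪ X.erase x) (τ - h x) := by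
  have hxB : x ∉ B := fun hxB => Finset.disjoint_left.mp hd hxB hx
  rw [soloBlind_mass_erase h (Finset.mem_union_right B hx) τ, soloBlind_union_erase_eq hxB]

/-- If no target `τ - ∑_{i ∈ C} h i` (`C ⊆ X`) is representable in `B`, then `K(τ; B ∪ X) = 0`. -/
theorem soloBlind_mass_union_eq_zero_of_absent (h : ι → G) {B X : Finset ι} (hd : Disjoint B X) {τ : G}
    (habs : ∀ C ⊆ X, soloBlindSeqRepAll h B (τ - ∑ i ∈ C, h i) = ∅) :
    soloBlindMass h (B ∪ X) τ = 0 := by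
  rw [soloBlind_mass_union_powerset h hd τ]
  refine Finset.sum_eq_zero (fun C hC => ?_)
  rw [soloBlind_mass_eq_zero_of_repAll_eq_empty (habs C (Finset.mem_powerset.mp hC)), mul_zero]

/-- PRESENCE STEP FOR (K₃): if the representations are one-sided in `x ∈ X` (no `τ - h x - ∑_C h`, or no
`τ - ∑_C h`, `C ⊆ X \ {x}`, is representable in `B`), then (K₃) for `B ∪ (X \ {x})` (all targets) gives
`K(τ; B ∪ X) ≤ 1`. -/
theorem soloBlind_kraft_presence_step (h : ι → G) {B X : Finset ι} (hd : Disjoint B X) {x : ι} (hx : x ∈ X)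
    {τ : G} (IH : ∀ τ', soloBlindMass h (B ∪ X.erase x) τ' ≤ 1)
    (habs : (∀ C ⊆ X.erase x, soloBlindSeqRepAll h B (τ - h x - ∑ i ∈ C, h i) = ∅) ∨
      (∀ C ⊆ X.erase x, soloBlindSeqRepAll h B (τ - ∑ i ∈ C, h i) = ∅)) :
    soloBlindMass h (B ∪ X) τ ≤ 1 := by
  have hd' : Disjoint B (X.erase x) := Finset.disjoint_of_subset_right (Finset.erase_subset x X) hd
  rw [soloBlind_mass_union_step h hd hx τ]
  rcases habs with habs | habs
  · rw [soloBlind_mass_union_eq_zero_of_absent h hd' habs, mul_zero, add_zero]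
    exact IH τ
  · rw [soloBlind_mass_union_eq_zero_of_absent h hd' habs, zero_add]
    linarith [IH (τ - h x)]

/-- PRESENCE STEP FOR CONJECTURE E: under the same one-sidedness, (K₃) for `B ∪ (X \ {x})` (all targets) and E
for `B ∪ (X \ {x})` at `τ` give `E(τ; B ∪ X) ≤ 1/2`. -/
theorem soloBlind_conjE_presence_step (h : ι → G) {B X : Finset ι} (hd : Disjoint B X) {x : ι} (hx : x ∈ X)
    {τ : G} (IHK : ∀ τ', soloBlindMass h (B ∪ X.erase x) τ' ≤ 1)
    (IHE : soloBlindMass h (B ∪ X.erase x) τ ≤ 1 / 2)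
    (habs : (∀ C ⊆ X.erase x, soloBlindSeqRepAll h B (τ - h x - ∑ i ∈ C, h i) = ∅) ∨
      (∀ C ⊆ X.erase x, soloBlindSeqRepAll h B (τ - ∑ i ∈ C, h i) = ∅)) :
    soloBlindMass h (B ∪ X) τ ≤ 1 / 2 := by
  have hd' : Disjoint B (X.erase x) := Finset.disjoint_of_subset_right (Finset.erase_subset x X) hd
  rw [soloBlind_mass_union_step h hd hx τ]
  rcases habs with habs | habs
  · rw [soloBlind_mass_union_eq_zero_of_absent h hd' habs, mul_zero, add_zero]
    exact IHE
  · rw [soloBlind_mass_union_eq_zero_of_absent h hd' habs, zero_add]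
    linarith [IHK (τ - h x)]

/-- TWO-SIDEDNESS, contrapositive form: if (K₃) holds for `B ∪ (X \ {x})` but fails for `B ∪ X` at `τ`, then both a
target `τ - ∑_C h` and a shifted target `τ - h x - ∑_{C'} h` (`C, C' ⊆ X \ {x}`) are representable in `B`. -/
theorem soloBlind_kraft_twoSided_of_gt (h : ι → G) {B X : Finset ι} (hd : Disjoint B X) {x : ι} (hx : x ∈ X)
    {τ : G} (IH : ∀ τ', soloBlindMass h (B ∪ X.erase x) τ' ≤ 1) (hgt : 1 < soloBlindMass h (B ∪ X) τ) :
    (∃ C ⊆ X.erase x, (soloBlindSeqRepAll h B (τ - ∑ i ∈ C, h i)).Nonempty) ∧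
      (∃ C ⊆ X.erase x, (soloBlindSeqRepAll h B (τ - h x - ∑ i ∈ C, h i)).Nonempty) := by
  by_contra hne
  rw [not_and_or] at hne
  push Not at hne
  have habs : (∀ C ⊆ X.erase x, soloBlindSeqRepAll h B (τ - h x - ∑ i ∈ C, h i) = ∅) ∨
      (∀ C ⊆ X.erase x, soloBlindSeqRepAll h B (τ - ∑ i ∈ C, h i) = ∅) := by
    rcases hne with hne | hne
    · exact Or.inr hne
    · exact Or.inl hne
  exact absurd (soloBlind_kraft_presence_step h hd hx IH habs) (not_le.mpr hgt)

end Summit.MatrixMultiplication.MatrixMultiplication.Theorems
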